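import Mathlib
import Literature.Analysis.FluidPDE.LeiZhang2017AxisymmetricCriteria
import Literature.Analysis.FluidPDE.LeiZhang2017AxisymmetricCriteriaProofs
import Literature.Analysis.FluidPDE.LeiZhang2017SmallSwirlProof
import Literature.Analysis.FluidPDE.Seregin2022LogSwirlCriterion
import Literature.Analysis.FluidPDE.Seregin2020AxisymmetricTypeII
import Literature.Analysis.FluidPDE.SereginSverakPressureDecayBalls
import HarnessLib.Audit
import HarnessLib

/-!
# SwirlThresholdLadder — threshold functions in the axisymmetric class (ROUND-13, seat nsreg-p2)

Two printed families of regularity criteria for axisymmetric Navier–Stokes flows carry an explicit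
THRESHOLD FUNCTION; this file types both families as one-parameter ladders, puts the printed rungs
on them BY NAME, proves the order relations between rungs, and types the endpoints, which are the
two questions Lei–Ren leave open in print (Adv. Math. 457 (2024) 109654 = arXiv:2210.01783, p. 6):

* the **axis-modulus ladder** (global frame of the tree facts `Wei2016_logModulus_regularity`,
  `LeiZhang2017_logModulus_regularity`, `ν = 1`): `SwirlModulusCriterion m` = "every classical
  Leray–Hopf solution on `[0,T)` from a rapidly decaying datum with axisymmetric slices whose swirl
  obeys `|Γ(t,x)| ≤ m(r)` for `0 < r ≤ δ₀` extends past `T`".  Printed rungs: `m(r) = C₁/(ln r)²`,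
  any `C₁ > 1` (Lei–Zhang 2017 Cor. 1.3) and `m(r) = |ln r|^{-3/2}` (Wei 2016 Cor. 1.1).  Kernel:
  `wei_iff`, `leiZhang_iff` (the facts ARE rungs), `SwirlModulusCriterion.mono`,
  `SwirlModulusCriterion.of_logRung` (a rung with a slower-decaying log-modulus implies every rung
  with a faster one, constants absorbed), reproducing the tree theorem
  `LeiZhang2017_logModulus_regularity_of_wei2016` (Wei's fact implies Lei–Zhang's — the printed
  remark "clearly our Cor. 1.1 improves [LZ]") as `logRung_two_of_wei_rung`,
  and the ENDPOINT `AxisSwirlThreshold ε := 0 < ε ∧ SwirlModulusCriterion (fun _ ↦ ε)` (an ABSOLUTE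
  constant, exponent 0): `AxisSwirlThreshold ε → Wei2016_logModulus_regularity` and `→` every log rung with
  any constant (`logRung_of_axisSwirlThreshold`).  `AxisymContinuation := ∀ M, SwirlModulusCriterion
  (fun _ ↦ M)` is the continuation form of axisymmetric-with-swirl regularity in this frame (hard
  core `AxisymSwirlRegular`, stmt-…-1964, up to the existence/continuation glue) and trivially gives
  every `AxisSwirlThreshold ε`.
* the **datum-gauge ladder** `RelDatumSwirlThreshold κ` (threshold `‖Γ₀‖_∞ ≤ δ M₀^{-κ}`, `M₀` =
  Lei–Zhang's data functional `LeiZhang2017.M0`): the rung `κ = 1` IS A TREE THEOREM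
  (`relDatumSwirlThreshold_one`, from the sorry-free `LeiZhang2017_smallSwirl_regularity_holds`);
  `κ = 0` is `AbsoluteDatumSwirlThreshold` (`relDatumSwirlThreshold_zero_iff`), the `ν = 1` twin of
  the ledger crux `SwirlThreshold.SmallSwirlRegularity` (stmt-…-2002). OPEN. Next to it the
  **log-datum ladder** `LogDatumSwirlThreshold α` (threshold `c (ln(2 + M₀))^{-α}`; Wei 2016 Remark
  1.1(b) prints `α = 3/2` in his own normalisation): `α = 0` ↔ absolute
  (`logDatumSwirlThreshold_zero_iff`), absolute ⇒ every rung (`logDatum_of_absolute`), monotone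
  (`LogDatumSwirlThreshold.mono`).

The LOCAL ladders of the same memo (small-swirl threshold `LocalSwirlThreshold`, local axis modulus
`LocalSwirlModulusCriterion`, Type-II excess `DissipationGrowthCriterion`) are the sequel file
`…Theorems.SwirlThresholdLadderLocal` (split for the 400-line rule; independent of this file).

Nothing here is a regularity theorem (except the cited tree rung `κ = 1`): the open nodes are `def`s tagged `@[conjecture]`, the printed
rungs enter as hypotheses or through the tree's named facts, and every `theorem` is order
bookkeeping between typed statements.
-/

namespace Summit.NavierStokesRegularity.NavierStokesRegularity.Theorems.SwirlThresholdLadder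

open MeasureTheory Set Filter Topology
open scoped ENNReal NNReal
open Literature.Analysis.FluidPDE

local notation "ℝ³" => EuclideanSpace ℝ (Fin 3)

noncomputable section

/-! ## A. The axis-modulus ladder (global frame, `ν = 1`) -/

/-- `SwirlModulusCriterion m`: the regularity criterion with axis modulus `m` in the frame of the
tree facts `Wei2016_logModulus_regularity` / `LeiZhang2017_logModulus_regularity` — every classical
solution of Navier–Stokes (`ν = 1`, no force) on `[0,T)`, Leray–Hopf from a rapidly decaying datum,
with axisymmetric slices, whose swirl satisfies `|Γ(t,x)| ≤ m(r)` for `t ∈ [0,T)` and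
`0 < r = cylRadius x ≤ δ₀` (some `δ₀ ∈ (0,1/2)`), extends smoothly past `T`. -/
def SwirlModulusCriterion (m : ℝ → ℝ) : Prop :=
  ∀ δ₀ : ℝ, 0 < δ₀ → δ₀ < 1 / 2 →
    ∀ (T : ℝ) (u : ℝ → ℝ³ → ℝ³) (p : ℝ → ℝ³ → ℝ), 0 < T →
    IsClassicalNSSolutionOn (Ico 0 T) 1 0 u p → IsLerayHopfOn T 1 0 (u 0) u →
    HasRapidSpatialDecay (u 0) → (∀ t ∈ Ico 0 T, IsAxisymmetric (u t)) →
    eLpNorm (swirl (u 0)) ∞ volume < ∞ →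
    (∀ t ∈ Ico 0 T, ∀ x : ℝ³, 0 < cylRadius x → cylRadius x ≤ δ₀ →
      |swirl (u t) x| ≤ m (cylRadius x)) →
    HasSmoothExtensionPast 1 0 u T

/-- The logarithmic modulus `logModulus α C r = C |ln r|^{-α}` (real power).  For `0 < r < 1`
this is `C |Real.log r| ^ (-α)` with `|ln r| > 0`; at `r = 1` Mathlib's `Real.rpow` gives
`0 ^ (-α) = 0` for `α ≠ 0` (and `1` for `α = 0`), irrelevant since `SwirlModulusCriterion` only
evaluates the modulus at `0 < r ≤ δ₀ < 1/2`.  Only `C > 0` gives a genuine rung: for `C ≤ 0` the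
hypothesis `|Γ| ≤ logModulus α C r ≤ 0` near the axis is (essentially) unsatisfiable, so
`SwirlModulusCriterion (logModulus α C)` holds vacuously — rungs are quoted with `0 < C` below. -/
def logModulus (α C : ℝ) (r : ℝ) : ℝ := C * |Real.log r| ^ (-α)

/-- **Wei 2016 Cor. 1.1 IS the rung `m(r) = |ln r|^{-3/2}`** (definitional). -/
theorem wei_iff :
    Wei2016_logModulus_regularity ↔
      SwirlModulusCriterion (fun r => |Real.log r| ^ (-(3 / 2 : ℝ))) := Iff.rfl

/-- Wei's rung in `logModulus` form (constant exactly `1`). -/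
theorem wei_iff' : Wei2016_logModulus_regularity ↔ SwirlModulusCriterion (logModulus (3 / 2) 1) := by
  rw [wei_iff]
  have : (fun r : ℝ => |Real.log r| ^ (-(3 / 2 : ℝ))) = logModulus (3 / 2) 1 := by
    funext r; simp [logModulus]
  rw [this]

/-- `C₁ / (ln r)² = C₁ |ln r|^{-2}` everywhere (both are `0` where `ln r = 0`). -/
theorem div_log_sq_eq_logModulus (C₁ r : ℝ) :
    C₁ / Real.log r ^ 2 = logModulus 2 C₁ r := by
  unfold logModulus
  by_cases h : Real.log r = 0
  · simp [h, Real.zero_rpow (by norm_num : (-2 : ℝ) ≠ 0)]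
  · have hpos : 0 < |Real.log r| := abs_pos.2 h
    rw [div_eq_mul_inv, ← sq_abs, show |Real.log r| ^ 2 = |Real.log r| ^ (2 : ℝ) by
      rw [Real.rpow_two], ← Real.rpow_neg hpos.le]

/-- **Lei–Zhang 2017 Cor. 1.3 IS the family of rungs `m(r) = C₁/(ln r)²`, `C₁ > 1`.**  (The printed
hypothesis is stated without the guard `0 < r`; on the axis `Γ = 0` and `C₁/(ln 0)² = 0`, so the two
forms agree.) -/
theorem leiZhang_iff :
    LeiZhang2017_logModulus_regularity ↔
      ∀ C₁ : ℝ, 1 < C₁ → SwirlModulusCriterion (fun r => C₁ / Real.log r ^ 2) := by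
  constructor
  · intro h C₁ hC₁ δ₀ hδ₀ hδ T u p hT hcl hLH hdec haxi hΓ hmod
    refine h δ₀ C₁ hδ₀ hδ hC₁ T u p hT hcl hLH hdec haxi hΓ ?_
    intro t ht x hx
    rcases (cylRadius_nonneg x).eq_or_lt with h0 | hpos
    · rw [swirl_eq_zero_of_cylRadius_eq_zero (u t) h0.symm, ← h0]
      simp
    · exact hmod t ht x hpos hx
  · intro h δ₀ C₁ hδ₀ hδ hC₁ T u p hT hcl hLH hdec haxi hΓ hmod
    exact h C₁ hC₁ δ₀ hδ₀ hδ T u p hT hcl hLH hdec haxi hΓ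
      (fun t ht x _ hx => hmod t ht x hx)

/-- Lei–Zhang's family in `logModulus` form. -/
theorem leiZhang_iff' :
    LeiZhang2017_logModulus_regularity ↔ ∀ C₁ : ℝ, 1 < C₁ → SwirlModulusCriterion (logModulus 2 C₁) := by
  rw [leiZhang_iff]
  refine forall₂_congr fun C₁ _ => ?_
  have : (fun r : ℝ => C₁ / Real.log r ^ 2) = logModulus 2 C₁ := by
    funext r; exact div_log_sq_eq_logModulus C₁ r
  rw [this]

/-- **Monotonicity of the ladder.**  A criterion that tolerates the modulus `m₂` near the axis
implies the criterion for any modulus `m₁ ≤ m₂` on some `(0, δ₁]` (the hypothesis `|Γ| ≤ m₁` is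
stronger there). -/
theorem SwirlModulusCriterion.mono {m₁ m₂ : ℝ → ℝ} (h : SwirlModulusCriterion m₂)
    (hle : ∃ δ₁ : ℝ, 0 < δ₁ ∧ ∀ r : ℝ, 0 < r → r ≤ δ₁ → m₁ r ≤ m₂ r) :
    SwirlModulusCriterion m₁ := by
  obtain ⟨δ₁, hδ₁, hle⟩ := hle
  intro δ₀ hδ₀ hδ T u p hT hcl hLH hdec haxi hΓ hmod
  have hmin : 0 < min δ₀ δ₁ := lt_min hδ₀ hδ₁
  have hmin' : min δ₀ δ₁ < 1 / 2 := lt_of_le_of_lt (min_le_left _ _) hδ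
  refine h (min δ₀ δ₁) hmin hmin' T u p hT hcl hLH hdec haxi hΓ ?_
  intro t ht x hx hxδ
  exact (hmod t ht x hx (hxδ.trans (min_le_left _ _))).trans
    (hle _ hx (hxδ.trans (min_le_right _ _)))

/-- Real-analysis core of the ordering: for exponents `α < β` and `C₂ > 0`, the faster-decaying
modulus `C₁|ln r|^{-β}` lies below `C₂|ln r|^{-α}` on some `(0, δ₁]`. -/
theorem exists_logModulus_le {α β : ℝ} (hαβ : α < β) (C₁ : ℝ) {C₂ : ℝ} (hC₂ : 0 < C₂) :
    ∃ δ₁ : ℝ, 0 < δ₁ ∧ ∀ r : ℝ, 0 < r → r ≤ δ₁ → logModulus β C₁ r ≤ logModulus α C₂ r := by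
  have hγ : 0 < β - α := sub_pos.2 hαβ
  have ht : Tendsto (fun t : ℝ => C₁ * t ^ (-(β - α))) atTop (𝓝 (C₁ * 0)) :=
    (tendsto_rpow_neg_atTop hγ).const_mul C₁
  rw [mul_zero] at ht
  obtain ⟨M, hM⟩ := Filter.eventually_atTop.1 (ht.eventually (gt_mem_nhds hC₂))
  refine ⟨Real.exp (-(max M 1)), Real.exp_pos _, fun r hr hrδ => ?_⟩
  have hlog : Real.log r ≤ -(max M 1) := by
    have := Real.log_le_log hr hrδ
    rwa [Real.log_exp] at this
  have habs : max M 1 ≤ |Real.log r| := by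
    have h1 : max M 1 ≤ -Real.log r := by linarith
    exact h1.trans (neg_le_abs _)
  have htpos : 0 < |Real.log r| := lt_of_lt_of_le (lt_of_lt_of_le one_pos (le_max_right M 1)) habs
  have hMt : M ≤ |Real.log r| := (le_max_left M 1).trans habs
  have key : C₁ * |Real.log r| ^ (-(β - α)) < C₂ := hM _ hMt
  unfold logModulus
  have hsplit : |Real.log r| ^ (-β) = |Real.log r| ^ (-(β - α)) * |Real.log r| ^ (-α) := by
    rw [← Real.rpow_add htpos]; ring_nf
  rw [hsplit, ← mul_assoc]
  exact mul_le_mul_of_nonneg_right key.le (Real.rpow_nonneg htpos.le _)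

/-- **Ordering of log rungs.**  A rung with the slower-decaying modulus `C₂|ln r|^{-α}` (`C₂ > 0`)
implies every rung with a faster-decaying modulus `C₁|ln r|^{-β}`, `β > α`, whatever `C₁` (for
`C₁ ≤ 0` the concluded rung is the vacuous one, see `logModulus`; the content is `C₁ > 0`). -/
theorem SwirlModulusCriterion.of_logRung {α β C₂ : ℝ} (h : SwirlModulusCriterion (logModulus α C₂))
    (hαβ : α < β) (hC₂ : 0 < C₂) (C₁ : ℝ) : SwirlModulusCriterion (logModulus β C₁) :=
  h.mono (exists_logModulus_le hαβ C₁ hC₂)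

/-- **Wei 2016 ⇒ Lei–Zhang 2017** between the two tree facts is ALREADY the tree theorem
`Literature.Analysis.FluidPDE.LeiZhang2017_logModulus_regularity_of_wei2016` (cited, not restated).
The ladder calculus reproduces it: the rung `logModulus (3/2) 1` (Wei, `wei_iff'`) implies every
rung `logModulus 2 C₁` (Lei–Zhang up to `leiZhang_iff'`) by `of_logRung` (exponent `3/2 < 2`,
constant `1` absorbs any `C₁`). -/
theorem logRung_two_of_wei_rung (h : SwirlModulusCriterion (logModulus (3 / 2) 1)) (C₁ : ℝ) :
    SwirlModulusCriterion (logModulus 2 C₁) :=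
  h.of_logRung (by norm_num) one_pos C₁

/-- **The endpoint: the ABSOLUTE axis-swirl threshold** (exponent `0`, small absolute constant).
`AxisSwirlThreshold ε`: every frame solution with `|Γ(t,x)| ≤ ε` for `t ∈ [0,T)`, `0 < r ≤ δ₀`
extends past `T` (the sign guard `0 < ε` is part of the node, so no `ε ≤ 0` instance can close
it).  OPEN for every `ε > 0` (Lei–Ren 2024 p. 6, in the local form
`AbsoluteLocalSmallSwirl` below: "beyond the reach of existing methods"); print is RELATIVE
(Lei–Zhang 2017 Thm. 1.4: `sup_t ‖Γ(t)‖_{L^∞(r ≤ r₀)} ≤ δ M₁⁻¹`; Lei–Ren 2024 Thm. 3).  By the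
maximum principle `‖Γ(t)‖_∞ ≤ ‖Γ₀‖_∞` (tree: `abs_swirl_le_of_classical`) it yields the datum form,
the ledger crux `SwirlThreshold.SmallSwirlRegularity` (stmt-…-2002), modulo symmetry propagation
and local boundedness of the velocity (not typed here). -/
@[conjecture] def AxisSwirlThreshold (ε : ℝ) : Prop := 0 < ε ∧ SwirlModulusCriterion (fun _ => ε)

/-- The endpoint is the exponent-`0` rung of the log-modulus ladder (with the sign guard):
`AxisSwirlThreshold ε ↔ 0 < ε ∧ SwirlModulusCriterion (logModulus 0 ε)`. -/
theorem axisSwirlThreshold_iff_logModulus_zero (ε : ℝ) :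
    AxisSwirlThreshold ε ↔ 0 < ε ∧ SwirlModulusCriterion (logModulus 0 ε) := by
  have : (fun _ : ℝ => ε) = logModulus 0 ε := by
    funext r; simp [logModulus]
  unfold AxisSwirlThreshold
  rw [this]

/-- The endpoint dominates the whole log ladder: an absolute threshold `ε > 0` implies the criterion
with modulus `C|ln r|^{-β}` for EVERY `β > 0` and EVERY constant `C` (a genuine rung for `C > 0`). -/
theorem logRung_of_axisSwirlThreshold {ε : ℝ} (h : AxisSwirlThreshold ε)
    {β : ℝ} (hβ : 0 < β) (C : ℝ) : SwirlModulusCriterion (logModulus β C) := by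
  rw [axisSwirlThreshold_iff_logModulus_zero] at h
  exact h.2.of_logRung hβ h.1 C

/-- In particular the endpoint implies Wei's fact (and hence Lei–Zhang's). -/
theorem wei_of_axisSwirlThreshold {ε : ℝ} (h : AxisSwirlThreshold ε) :
    Wei2016_logModulus_regularity :=
  wei_iff'.2 (logRung_of_axisSwirlThreshold h (by norm_num) 1)

/-- The absolute endpoint implies Lei–Zhang's log rung (every constant `C₁ > 1`). -/
theorem leiZhang_of_axisSwirlThreshold {ε : ℝ} (h : AxisSwirlThreshold ε) :
    LeiZhang2017_logModulus_regularity :=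
  LeiZhang2017_logModulus_regularity_of_wei2016 (wei_of_axisSwirlThreshold h)

/-- Monotonicity in the absolute constant (`0 < ε' ≤ ε`). -/
theorem AxisSwirlThreshold.mono {ε ε' : ℝ} (h : AxisSwirlThreshold ε) (hε' : 0 < ε') (hle : ε' ≤ ε) :
    AxisSwirlThreshold ε' :=
  ⟨hε', SwirlModulusCriterion.mono h.2 ⟨1, one_pos, fun _ _ _ => hle⟩⟩

/-- The top of the ladder: continuation for EVERY bound on the near-axis swirl (exponent `0`,
arbitrary constant) — the continuation form, in this frame, of axisymmetric-with-swirl global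
regularity (hard core `AxisymSwirlRegular`, stmt-…-1964; since `Γ` is always bounded by
`‖Γ₀‖_∞`, the hypothesis is no restriction). -/
@[conjecture] def AxisymContinuation : Prop := ∀ M : ℝ, SwirlModulusCriterion (fun _ => M)

/-- Axisymmetric continuation (every constant modulus) trivially gives every absolute threshold
`ε > 0` (an edge `AxisymContinuation ⇒ AxisSwirlThreshold ε`, conditional on the open top node). -/
theorem axisSwirlThreshold_of_axisymContinuation (h : AxisymContinuation) {ε : ℝ} (hε : 0 < ε) :
    AxisSwirlThreshold ε := ⟨hε, h ε⟩


/-! ## A′. The datum-gauge threshold ladder (relative to Lei–Zhang's `M₀`, global frame, `ν = 1`) -/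

/-- `RelDatumSwirlThreshold κ`: in the frame of the tree fact `LeiZhang2017_smallSwirl_regularity`
(Lei–Zhang 2017 Thm. 1.4, PROVED in the tree: `LeiZhang2017_smallSwirl_regularity_holds`), the
datum threshold `‖Γ₀‖_{L^∞} ≤ δ · M₀^{-κ}` with an ABSOLUTE `δ > 0`, where
`M₀ = (‖Ω₀‖_{L²} + ‖V₀²‖_{L²}) ‖Γ₀‖_{L²}` is Lei–Zhang's dimensionless data functional (`M0`).
`κ = 1` is the printed (and tree-proved) rung; `κ = 0` is the ABSOLUTE datum threshold. -/
@[conjecture] def RelDatumSwirlThreshold (κ : ℝ) : Prop :=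
  ∃ δ : ℝ, 0 < δ ∧ ∀ (T : ℝ) (u : ℝ → ℝ³ → ℝ³) (p : ℝ → ℝ³ → ℝ), 0 < T →
    IsClassicalNSSolutionOn (Ico 0 T) 1 0 u p → IsLerayHopfOn T 1 0 (u 0) u →
    HasRapidSpatialDecay (u 0) → (∀ t ∈ Ico 0 T, IsAxisymmetric (u t)) →
    eLpNorm (LeiZhang2017.bigOmega (u 0)) 2 volume < ∞ →
    eLpNorm (LeiZhang2017.vSq (u 0)) 2 volume < ∞ →
    eLpNorm (swirl (u 0)) 2 volume < ∞ → eLpNorm (swirl (u 0)) ∞ volume < ∞ →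
    eLpNorm (swirl (u 0)) ∞ volume ≤ ENNReal.ofReal δ / LeiZhang2017.M0 (u 0) ^ κ →
    HasSmoothExtensionPast 1 0 u T

/-- **The ABSOLUTE datum threshold** (`Re_c > 0` in the datum gauge, `ν = 1`): `‖Γ₀‖_{L^∞} ≤ δ`
for an absolute `δ` forces continuation — the `ν = 1`, Lei–Zhang-frame twin of the ledger crux
`SwirlThreshold.SmallSwirlRegularity` (stmt-…-2002, `|Γ₀| ≤ ε ν`). OPEN. -/
@[conjecture] def AbsoluteDatumSwirlThreshold : Prop :=
  ∃ δ : ℝ, 0 < δ ∧ ∀ (T : ℝ) (u : ℝ → ℝ³ → ℝ³) (p : ℝ → ℝ³ → ℝ), 0 < T →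
    IsClassicalNSSolutionOn (Ico 0 T) 1 0 u p → IsLerayHopfOn T 1 0 (u 0) u →
    HasRapidSpatialDecay (u 0) → (∀ t ∈ Ico 0 T, IsAxisymmetric (u t)) →
    eLpNorm (LeiZhang2017.bigOmega (u 0)) 2 volume < ∞ →
    eLpNorm (LeiZhang2017.vSq (u 0)) 2 volume < ∞ →
    eLpNorm (swirl (u 0)) 2 volume < ∞ → eLpNorm (swirl (u 0)) ∞ volume < ∞ →
    eLpNorm (swirl (u 0)) ∞ volume ≤ ENNReal.ofReal δ →
    HasSmoothExtensionPast 1 0 u T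

/-- **The rung `κ = 1` is a theorem of the tree** (Lei–Zhang 2017 Thm. 1.4, sorry-free:
`LeiZhang2017_smallSwirl_regularity_holds`). -/
theorem relDatumSwirlThreshold_one : RelDatumSwirlThreshold 1 := by
  obtain ⟨δ, hδ, h⟩ := LeiZhang2017_smallSwirl_regularity_holds
  refine ⟨δ, hδ, fun T u p hT hcl hLH hdec haxi hΩ hV hΓ2 hΓ hsmall => ?_⟩
  rw [ENNReal.rpow_one] at hsmall
  exact h T u p hT hcl hLH hdec haxi hΩ hV hΓ2 hΓ hsmall

/-- `κ = 0` is the absolute datum threshold. -/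
theorem relDatumSwirlThreshold_zero_iff : RelDatumSwirlThreshold 0 ↔ AbsoluteDatumSwirlThreshold := by
  unfold RelDatumSwirlThreshold AbsoluteDatumSwirlThreshold
  simp only [ENNReal.rpow_zero, div_one]

/-! ### A″. The LOG-datum ladder (Wei-type thresholds `c · (ln(2 + M₀))^{-α}`)

Wei 2016, Thm. 1.1 / Remark 1.1(b) (arXiv:1508.03318 p. 3) prints a datum threshold that is
LOGARITHMIC in the data functional: `‖Γ₀‖_{L^∞} ≤ (1 + ln(C₀ (M₀^W)^{1/4} + 1))^{-3/2}` with
`M₀^W = (‖J₀‖_{L²} + ‖Ω₀‖_{L²}) ((1 + ‖Γ₀‖_{L^∞}) ‖u₀‖_{L²})³` — the exponent `3/2` once more. We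
type the log-datum family over Lei–Zhang's `M₀` (Wei's normalisation `M₀^W` is not typed here, so
the printed rung is NOT claimed as an instance): `α = 0` is the absolute threshold; every rung is
implied by the absolute threshold; the family is monotone in `α`. As typed it is INCOMPARABLE with
the power family `RelDatumSwirlThreshold κ` (`κ > 0`): at small `M₀` the power threshold `δ M₀^{-κ}`
is generous (large swirl allowed for dimensionless-small data, as in Lei–Zhang's theorem), which
no log rung reproduces, while at large `M₀` every log rung beats every power rung. -/

/-- `LogDatumSwirlThreshold α`: Lei–Zhang's frame, threshold `‖Γ₀‖_{L^∞} ≤ c · (ln(2 + M₀))^{-α}`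
for an absolute `c > 0` (`M₀` = `LeiZhang2017.M0`, read in `ℝ` via `toReal`; the frame's finiteness
hypotheses make `M₀ < ∞`). -/
@[conjecture] def LogDatumSwirlThreshold (α : ℝ) : Prop :=
  ∃ c : ℝ, 0 < c ∧ ∀ (T : ℝ) (u : ℝ → ℝ³ → ℝ³) (p : ℝ → ℝ³ → ℝ), 0 < T →
    IsClassicalNSSolutionOn (Ico 0 T) 1 0 u p → IsLerayHopfOn T 1 0 (u 0) u →
    HasRapidSpatialDecay (u 0) → (∀ t ∈ Ico 0 T, IsAxisymmetric (u t)) →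
    eLpNorm (LeiZhang2017.bigOmega (u 0)) 2 volume < ∞ →
    eLpNorm (LeiZhang2017.vSq (u 0)) 2 volume < ∞ →
    eLpNorm (swirl (u 0)) 2 volume < ∞ → eLpNorm (swirl (u 0)) ∞ volume < ∞ →
    eLpNorm (swirl (u 0)) ∞ volume ≤
      ENNReal.ofReal (c * Real.log (2 + (LeiZhang2017.M0 (u 0)).toReal) ^ (-α)) →
    HasSmoothExtensionPast 1 0 u T

/-- `ln(2 + m) ≥ ln 2 > 0` for `m ≥ 0`. -/
theorem log_two_le_log_two_add {m : ℝ} (hm : 0 ≤ m) : Real.log 2 ≤ Real.log (2 + m) :=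
  Real.log_le_log two_pos (by linarith)

/-- `α = 0` of the log-datum family is the absolute datum threshold. -/
theorem logDatumSwirlThreshold_zero_iff : LogDatumSwirlThreshold 0 ↔ AbsoluteDatumSwirlThreshold := by
  unfold LogDatumSwirlThreshold AbsoluteDatumSwirlThreshold
  simp only [neg_zero, Real.rpow_zero, mul_one]

/-- **The absolute threshold implies every log rung** (`α ≥ 0`): with `c = δ (ln 2)^α`,
`c (ln(2 + M₀))^{-α} ≤ δ`. -/
theorem logDatum_of_absolute {α : ℝ} (hα : 0 ≤ α) (h : AbsoluteDatumSwirlThreshold) :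
    LogDatumSwirlThreshold α := by
  obtain ⟨δ, hδ, h⟩ := h
  have hl2 : 0 < Real.log 2 := Real.log_pos one_lt_two
  refine ⟨δ * Real.log 2 ^ α, mul_pos hδ (Real.rpow_pos_of_pos hl2 α), ?_⟩
  intro T u p hT hcl hLH hdec haxi hΩ hV hΓ2 hΓ hsmall
  refine h T u p hT hcl hLH hdec haxi hΩ hV hΓ2 hΓ (hsmall.trans (ENNReal.ofReal_le_ofReal ?_))
  set L := Real.log (2 + (LeiZhang2017.M0 (u 0)).toReal) with hL
  have hL2 : Real.log 2 ≤ L := log_two_le_log_two_add ENNReal.toReal_nonneg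
  have hLpos : 0 < L := hl2.trans_le hL2
  have h1 : L ^ (-α) ≤ Real.log 2 ^ (-α) :=
    Real.rpow_le_rpow_of_nonpos hl2 hL2 (neg_nonpos.mpr hα)
  calc δ * Real.log 2 ^ α * L ^ (-α) ≤ δ * Real.log 2 ^ α * Real.log 2 ^ (-α) :=
        mul_le_mul_of_nonneg_left h1 (by positivity)
    _ = δ := by
        rw [mul_assoc, ← Real.rpow_add hl2, add_neg_cancel, Real.rpow_zero, mul_one]

/-- **The log-datum family is monotone in the exponent**: rung `α` implies rung `α'` for
`α ≤ α'` (with `c' = c (ln 2)^{α' - α}`). -/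
theorem LogDatumSwirlThreshold.mono {α α' : ℝ} (h : LogDatumSwirlThreshold α) (hle : α ≤ α') :
    LogDatumSwirlThreshold α' := by
  obtain ⟨c, hc, h⟩ := h
  have hl2 : 0 < Real.log 2 := Real.log_pos one_lt_two
  refine ⟨c * Real.log 2 ^ (α' - α), mul_pos hc (Real.rpow_pos_of_pos hl2 _), ?_⟩
  intro T u p hT hcl hLH hdec haxi hΩ hV hΓ2 hΓ hsmall
  refine h T u p hT hcl hLH hdec haxi hΩ hV hΓ2 hΓ (hsmall.trans (ENNReal.ofReal_le_ofReal ?_))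
  set L := Real.log (2 + (LeiZhang2017.M0 (u 0)).toReal) with hL
  have hL2 : Real.log 2 ≤ L := log_two_le_log_two_add ENNReal.toReal_nonneg
  have hLpos : 0 < L := hl2.trans_le hL2
  -- `(ln 2)^{α'-α} · L^{-(α'-α)} = (ln 2 / L)^{α'-α} ≤ 1`
  have hq : Real.log 2 ^ (α' - α) * L ^ (-(α' - α)) ≤ 1 := by
    rw [Real.rpow_neg hLpos.le, ← div_eq_mul_inv, ← Real.div_rpow hl2.le hLpos.le]
    exact Real.rpow_le_one (div_nonneg hl2.le hLpos.le) ((div_le_one hLpos).mpr hL2)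
      (sub_nonneg.mpr hle)
  have hsplit : L ^ (-α') = L ^ (-(α' - α)) * L ^ (-α) := by
    rw [← Real.rpow_add hLpos]; congr 1; ring
  calc c * Real.log 2 ^ (α' - α) * L ^ (-α')
      = c * (Real.log 2 ^ (α' - α) * L ^ (-(α' - α))) * L ^ (-α) := by rw [hsplit]; ring
    _ ≤ c * 1 * L ^ (-α) :=
        mul_le_mul_of_nonneg_right (mul_le_mul_of_nonneg_left hq hc.le)
          (Real.rpow_nonneg hLpos.le _)
    _ = c * L ^ (-α) := by rw [mul_one]

end

end Summit.NavierStokesRegularity.NavierStokesRegularity.Theorems.SwirlThresholdLadder
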